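import Literature.AnabelianGeometry.AbsoluteAnabelian.AbsTopIThm26vProofs
import Literature.AnabelianGeometry.AbsoluteAnabelian.AbsTopIThm214GroupPartHolds
import Literature.AnabelianGeometry.AbsoluteAnabelian.AbsTopII.Remark332Proofs
import HarnessLib

/-!
# [AbsTopI] Thm 2.6 (v) ⇒ Thm 2.14 (i) group part and [AbsTopII] Rmk 3.3.2, regime-conditional forms

S. Mochizuki, *Topics in Absolute Anabelian Geometry I: Generalities* (2012) [AbsTopI] (lit key
`paper:url-11ac98ba15fc`), Thm 2.6 (v) p. 22 / Thm 2.14 (i) p. 33, and *Topics in Absolute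
Anabelian Geometry II: Decomposition Groups and Endomorphisms* (2013) [AbsTopII], Rmk 3.3.2 p. 69
("when `k` is an MLF or an NF, the subgroup `Δ ⊆ Π` admits a purely group-theoretic
characterization [cf. [AbsTopI], Theorem 2.6, (v), (vi)]").

abc-iut-L4-t6's kernel theorems `preservesGeom_of_thm26v`, `thm214GroupPart_of_thm26v`,
`rmk_3_3_2_of_thm26v` take the typed [AbsTopI] Thm 2.6 (v) (`FundamentalExtension.Thm26v`, case
`Θ = {1}`) as a HYPOTHESIS; `AbsTopIThm26vProofs` (this seat) PROVED `Thm26v` for every abstract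
extension with MLF base data from the regime inputs of the printed proof ("it follows from assertion
(ii) [...] [cf. [Mzk6], Lemma 1.1.4, (ii)]", p. 24): `Δ` topologically finitely generated and
`δ¹_l(Π′) − δ¹_l(G′)` independent of `l` (`CoinvariantRankConstant`), resp. the printed hypotheses of
[AbsAnab] Lemma 1.1.4 (ii) (splitting over an open subgroup of `G`, `Δ` tfg, (∗)).  This proof-only
file substitutes, so that NO `Thm26v` hypothesis is left anywhere downstream:

* `preservesGeom_of_coinvariantRankConstant` / `_of_starCondition` — every isomorphism
  `Π₁ ⥲ Π₂` carries `Δ₁` onto `Δ₂`;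
* `thm214GroupPart_of_coinvariantRankConstant` / `_of_starCondition` — [AbsTopI] Thm 2.14 (i),
  group part ("`p₁ = p₂`", `Δ₁ ⥲ Δ₂`, `G₁ ⥲ G₂`, equal minimal almost-pro sets);
* `AbsTopII.rmk_3_3_2_MLF_of_coinvariantRankConstant` / `_of_starCondition` — [AbsTopII] Rmk 3.3.2,
  `k` an MLF, on the corresponding classes of extensions.

HONEST FRAMING: refereed, undisputed statements; the remaining inputs are the printed regime
hypotheses on the abstract extension (supplied in print by the geometry of the curve, [AbsTopI]
Prop 2.2 and the proof of Thm 2.6 (ii)); nothing here bears on [IUTchIII] Cor 3.12; typed ≠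
discharged elsewhere.
-/

noncomputable section

open Topology

namespace Literature.AnabelianGeometry.AbsoluteAnabelian

namespace FundamentalExtension

variable {E F : FundamentalExtension.{0}}

/-- `Δ` is preserved by EVERY isomorphism `Π_E ⥲ Π_F` of profinite groups between extensions with
MLF base data, `Δ` topologically finitely generated and `CoinvariantRankConstant` ([AbsTopI] Thm
2.6 (v): "the kernel of the quotient `Π ↠ G` may be characterized group-theoretically").
[cite: MochizukiAbsTopI2012, Thm 2.6 (v) p.22] -/
theorem preservesGeom_of_coinvariantRankConstant (BE : E.MLFBase) (BF : F.MLFBase)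
    (hE : IsTopologicallyFinitelyGenerated E.geom) (hcE : E.CoinvariantRankConstant)
    (hF : IsTopologicallyFinitelyGenerated F.geom) (hcF : F.CoinvariantRankConstant)
    (α : E.arith ≃ₜ* F.arith) : PreservesGeom α :=
  preservesGeom_of_thm26v (E.thm26v_of_coinvariantRankConstant BE hE hcE)
    (F.thm26v_of_coinvariantRankConstant BF hF hcF) α

/-- `Δ` is preserved by EVERY isomorphism `Π_E ⥲ Π_F` between extensions with MLF base data
satisfying the printed hypotheses of [AbsAnab] Lemma 1.1.4 (ii) (splitting over an open subgroup of
`G`, `Δ` tfg, (∗)). [cite: MochizukiAbsTopI2012, Thm 2.6 (v) p.22] -/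
theorem preservesGeom_of_starCondition (BE : E.MLFBase) (BF : F.MLFBase)
    (hsE : E.SplitsOverOpenSubgroup) (hE : IsTopologicallyFinitelyGenerated E.geom)
    (hstarE : E.StarCondition) (hsF : F.SplitsOverOpenSubgroup)
    (hF : IsTopologicallyFinitelyGenerated F.geom) (hstarF : F.StarCondition)
    (α : E.arith ≃ₜ* F.arith) : PreservesGeom α :=
  preservesGeom_of_thm26v (E.thm26v_of_starCondition BE hsE hE hstarE)
    (F.thm26v_of_starCondition BF hsF hF hstarF) α

/-- **[AbsTopI] Thm 2.14 (i), group-theoretic part, with the Thm 2.6 (v) hypothesis DISCHARGED**: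
for extensions `Π₁`, `Π₂` with MLF base data, `Δᵢ` topologically finitely generated and
`CoinvariantRankConstant`, EVERY isomorphism `φ : Π₁ ⥲ Π₂` satisfies `Thm214GroupPart B₁ B₂ φ`
("`p₁ = p₂`"; `φ` induces `Δ₁ ⥲ Δ₂`, `G₁ ⥲ G₂`; equal minimal almost-pro sets).
[cite: MochizukiAbsTopI2012, Thm 2.14 (i) p.33] -/
theorem thm214GroupPart_of_coinvariantRankConstant (B₁ : E.MLFBase) (B₂ : F.MLFBase)
    (hE : IsTopologicallyFinitelyGenerated E.geom) (hcE : E.CoinvariantRankConstant)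
    (hF : IsTopologicallyFinitelyGenerated F.geom) (hcF : F.CoinvariantRankConstant)
    (φ : E.arith ≃ₜ* F.arith) : Thm214GroupPart B₁ B₂ φ :=
  thm214GroupPart_of_thm26v (E.thm26v_of_coinvariantRankConstant B₁ hE hcE)
    (F.thm26v_of_coinvariantRankConstant B₂ hF hcF) φ

/-- [AbsTopI] Thm 2.14 (i), group-theoretic part, for extensions with MLF base data satisfying the
printed hypotheses of [AbsAnab] Lemma 1.1.4 (ii) (splitting, `Δ` tfg, (∗)), every isomorphism
`φ : Π₁ ⥲ Π₂`. [cite: MochizukiAbsTopI2012, Thm 2.14 (i) p.33] -/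
theorem thm214GroupPart_of_starCondition (B₁ : E.MLFBase) (B₂ : F.MLFBase)
    (hsE : E.SplitsOverOpenSubgroup) (hE : IsTopologicallyFinitelyGenerated E.geom)
    (hstarE : E.StarCondition) (hsF : F.SplitsOverOpenSubgroup)
    (hF : IsTopologicallyFinitelyGenerated F.geom) (hstarF : F.StarCondition)
    (φ : E.arith ≃ₜ* F.arith) : Thm214GroupPart B₁ B₂ φ :=
  thm214GroupPart_of_thm26v (E.thm26v_of_starCondition B₁ hsE hE hstarE)
    (F.thm26v_of_starCondition B₂ hsF hF hstarF) φ

/-- "`p₁ = p₂`" of [AbsTopI] Thm 2.14 (i) for an ARBITRARY isomorphism `φ : Π₁ ⥲ Π₂` between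
extensions with MLF base data, `Δᵢ` tfg and `CoinvariantRankConstant` — the residue characteristic
is a group-theoretic invariant of `Π`. [cite: MochizukiAbsTopI2012, Thm 2.14 (i) p.33] -/
theorem residueChar_eq_of_coinvariantRankConstant (B₁ : E.MLFBase) (B₂ : F.MLFBase)
    (hE : IsTopologicallyFinitelyGenerated E.geom) (hcE : E.CoinvariantRankConstant)
    (hF : IsTopologicallyFinitelyGenerated F.geom) (hcF : F.CoinvariantRankConstant)
    (φ : E.arith ≃ₜ* F.arith) : B₁.p = B₂.p :=
  (thm214GroupPart_of_coinvariantRankConstant B₁ B₂ hE hcE hF hcF φ).1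

end FundamentalExtension

namespace AbsTopII

open FundamentalExtension

/-- **[AbsTopII] Remark 3.3.2, `k` an MLF, with the Thm 2.6 (v) hypothesis DISCHARGED**: on the
class of extensions `1 → Δ → Π → G → 1` with MLF base data `G ≅ G_K`, `Δ` topologically finitely
generated ([AbsTopI] Prop 2.2) and `δ¹_l(Π′) − δ¹_l(G′)` independent of `l` for every open `Π′`
([AbsTopI] Thm 2.6 (ii) applied to the open subgroups, `Σ` = all primes — the case of
[IUTchI–III]), every isomorphism of the profinite groups `Π` of two members carries `Δ` onto `Δ`:
"the subgroup `Δ ⊆ Π` admits a purely group-theoretic characterization [cf. [AbsTopI], Theorem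
2.6, (v)]". [cite: MochizukiAbsTopII2013, Rmk 3.3.2 p.69] -/
theorem rmk_3_3_2_MLF_of_coinvariantRankConstant :
    Rmk_3_3_2 {E : FundamentalExtension.{0} | ∃ _B : E.MLFBase,
      IsTopologicallyFinitelyGenerated E.geom ∧ E.CoinvariantRankConstant} := by
  refine rmk_3_3_2_of_thm26v.mono ?_
  rintro E ⟨B, h₁, h₂⟩
  exact ⟨B, E.thm26v_of_coinvariantRankConstant B h₁ h₂⟩

/-- [AbsTopII] Remark 3.3.2, `k` an MLF, on the class of extensions with MLF base data satisfying
the printed hypotheses of [AbsAnab] Lemma 1.1.4 (ii) (splitting over an open subgroup of `G`, `Δ`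
tfg, (∗)). [cite: MochizukiAbsTopII2013, Rmk 3.3.2 p.69] -/
theorem rmk_3_3_2_MLF_of_starCondition :
    Rmk_3_3_2 {E : FundamentalExtension.{0} | ∃ _B : E.MLFBase, E.SplitsOverOpenSubgroup ∧
      IsTopologicallyFinitelyGenerated E.geom ∧ E.StarCondition} := by
  refine rmk_3_3_2_of_thm26v.mono ?_
  rintro E ⟨B, h₁, h₂, h₃⟩
  exact ⟨B, E.thm26v_of_starCondition B h₁ h₂ h₃⟩

/-- Remark 3.3.2 is inherited by every sub-class of the MLF regime class (e.g. the extensions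
"arising from" hyperbolic orbicurves over MLF's once the campaign's `π₁` construction supplies the
regime inputs). [cite: MochizukiAbsTopII2013, Rmk 3.3.2 p.69] -/
theorem rmk_3_3_2_mono_MLF {𝒦 : Set FundamentalExtension.{0}}
    (h𝒦 : 𝒦 ⊆ {E | ∃ _B : E.MLFBase,
      IsTopologicallyFinitelyGenerated E.geom ∧ E.CoinvariantRankConstant}) : Rmk_3_3_2 𝒦 :=
  rmk_3_3_2_MLF_of_coinvariantRankConstant.mono h𝒦

end AbsTopII

end Literature.AnabelianGeometry.AbsoluteAnabelian
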